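import Literature.NumberTheory.EllipticCurves.Kato2004.EulerSystemDefinedValues
import Literature.NumberTheory.EllipticCurves.Isogeny
import Literature.NumberTheory.EllipticCurves.GlobalMinimalModel
import Literature.NumberTheory.EllipticCurves.ImaginaryPeriod
import HarnessLib

/-!
# Kato 2004 (Astérisque 295) (8.1.3) + Thm 9.7 + Thm 6.6 (1) case `ξ ∈ SL₂(ℤ)` + Thm 13.6 at Kato's MEMBER, with the
# dual exponential DEFINED per place (the clauses of `Kato2004.DefinedExpStarBody`) and its coordinate PINNED to the
# Néron differential by Tate duality — the «SL₂(ℤ)-type zeta values in a Néron coordinate» (ONE named fact)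

Topic `NumberTheory/EllipticCurves`, sub-directory `Kato2004` (namespace = path). ONE named fact
(`exists_member_sl2ZetaElement_neron_values`, a CLOSED `def … : Prop`, D-0014) and nothing else: no `_holds` (size XL:
Kato's explicit reciprocity law), nothing asserted. Typed by seat `bsd-wall-manin-p1` g8 (cell `pub/bsd-wall`) on the
ask of the F″-programme seats bsd-line-edix-p3 g4 / edix-p4 g3 (programme map `Summits/…/Cruxes/
StarredOptimalManinUnitFiveSeven/Lines/kato-lever-F2-programme.md` §4 «P1»; roadmap `Summits/…/Cruxes/ManinFrameResidueProper/
P4-ROADMAP-manin-p1-g8.md` §3/§5; draft of record `…/Lines/P1_DRAFT_KatoSL2NeronValues_manin_p1_g8.lean`, evidence #25 on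
stmt-BirchSwinnertonDyer-20709). CONSUMER: the F″ assembly — `Summits/…/Theorems/EdixhovenFibreFiveSevenStarredOptimal
ManinUnitFiveSevenAssemblySocket.lean` (`KatoAssemblySocket.kato_neron_five_le_of_memberValueLaw`, p600780: this fact ∘
receptacle (`ReceptacleTorsion.*`) ∘ per-factor `exp*` integrality (`PerFactorExpStarIntegral.*`, p600525) ∘ semi-local
descent (`SemiLocalDescent.*`, p598912) ∘ units (`KatoUnitChoice.*`, `PIntegralUnits.*`) ∘ value exit ⟹ F″ =
`kato_neron_isIntegral_twistedSymbolSum_of_additive_five_le`, hence cruxes 20709 / 22226 / 22227 / 23810 by their landed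
closers). SIBLINGS in format: `exists_eulerSystem_definedExpStar_values` (a(A)-type, abstract `κ`, all cyclotomic levels)
and `exists_member_eulerSystem_expStar_values` (member form); the deltas are: SL₂(ℤ)-type value law (Kato: «those with
ξ ∈ SL₂(ℤ) … take care of delicate integrality», p. 180), ONE level `m` at a time but EVERY `m ≥ 1` (general
`rootsOfUnityFixer ℚ m`, not only squarefree tame parts), the semi-local clauses PER PLACE (one line datum `dw` at every
`w ∣ p`, no Galois transport), and the PIN in place of the free constant. BSD is not proved by any of this.

## The printed statements (K. Kato, Astérisque 295 (2004); store key `paper:doi-10-24033-ast-639`)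
All quotations of `Kato2004/EulerSystemValues.lean` §"The printed statements" and of `EulerSystemValuesMember.lean` apply
((8.1.2)–(8.1.3) p. 180 — `m ≥ 1`, `ξ ∈ SL₂(ℤ)` allowed, `S ⊇ prime(mN) ∪ {p}`, `prime(cd) ∩ S = ∅`, `(cd, 6) = 1`,
`(d, N) = 1`; §8.3 p. 181 the lattice `V_{O_λ}(f)`; §9.4 p. 188 and Thm 9.7 p. 189 — `exp*` of the class is the zeta
modular form `_{c,d}z_m(f, r, r′, ξ, S) ∈ S(f) ⊗ ℚ(ζ_m)` (RATIONALITY); Thm 6.6 (1) p. 163 — for `ξ ∈ SL₂(ℤ)` and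
`c ≡ d ≡ 1 mod N`: `Σ_{b} χ(b) per_f(σ_b(_{c,d}z_m(f,r,r′,ξ,S)))^± = L_S(f*, χ, r)·(2πi)^{k−r−1}·γ^±`,
`γ = T·δ(f, r′, ξ)`, `T = (c² − c^u χ̄(c))(d² − d^v χ̄(d))` (print, BOTH bars; erratum F-UE-1 below), `(u, v) = (1, 1)` at `k = 2`, `r = r′ = 1` by (4.2.4);
§5.5 p. 156 / §4.7 p. 145 / §6.3 p. 162 — `δ(f, 1, ξ)` is the image of the Manin-symbol class of `ξ`; **Thm 13.6**
p. 227 (Ash–Stevens) — `V_{k,ℤ}(Y(L))` is generated over `ℤ` by the `α^* δ_{L,L}(k, j)`, `α ∈ SL₂(ℤ)`).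
[Kim–Nakamura 2020 / Kosters–Pannekoek 2017 are NOT used: the receptacle is now a tree theorem, `ReceptacleTorsion.*`.]

## The derivation (what is print, what is a reading — referee flags)
PRINT: existence and integrality of the class at Kato's lattice ((8.1.3)); rationality of its `exp*` (9.7); the value
law with `T` and `L_S` (6.6 (1)); Manin-symbol generation (13.6). MEMBER (as `exists_member_eulerSystem_expStar_values`):
`V_{ℤ_p}(f)(1)` is `Gal(ℚ̄/ℚ)`-isomorphic to `T_pW_K` for a globally minimal `W_K` `ℚ`-isogenous to `W` (tree theorem
`WeierstrassCurve.exists_isIsogenous_isGloballyMinimal_tateModule_equiv_of_stableRationalLattice`) — displayed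
existentially. DEFINED `exp*` + (RES)/(DEF): VERBATIM the clauses of `Kato2004.DefinedExpStarBody` (§9.4 + §11.3 +
[BK90] §3, Cassels–Fröhlich II §10), at ONE level `m` (Kato allows every `m ≥ 1`; F″ consumes one tame level at a time,
of arbitrary `m` coprime to `pN`). READING 1 (the PIN, replaces the free real constant `κ` of the sibling facts): the
generator `d` of `D⁰_dR(V_pW_K|_{Γ_{ℚ_v}})` is the class of the NÉRON differential `ω_{W_K}`, characterised WITHOUT a
comparison isomorphism by Tate duality — `range(exp*_d) = {a : Tr_{ℚ_v/ℚ_p}(a · log_ω E(ℚ_v)) ⊆ ℤ_p}` (Kato LNM 1553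
II Thm 1.4.1 (3)–(4) + [BK90] Prop 3.8 / Ex 3.10.1 (`κ(P) = exp(log_E P)`) / 3.11 — the statement of the tree fact
`PAdicHodge.exists_smul_range_expStarCoord_iff_trace_log` with `e = 1` for this `d`); Faltings' comparison and its
functoriality under the parametrisation `X₁(N) → W_K` identify `exp*_{ω_{W_K}}` with `(1/c_K)·exp*_f` and `Ω^±(W_K)`
with `c_K·u^±·Ω^±` of `per_f(f)` in Kato's lattice coordinates, so `c_K` CANCELS (programme map §1; the W2 cell files the
analogous Ω_f-normalised position as the conjecture-grade item `KatoPeriodPositionAtThree` — roadmap (A2): the referee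
must rule). READING 2 (coordinates): `n ξ ±` = the coordinate of `δ(f, 1, ξ)^±` in a `ℤ_(p)`-basis of
`V_ℤ(f)^± ⊗ ℤ_(p) ≅ H¹(W_K(ℂ), ℤ)^± ⊗ ℤ_(p)` times the real-structure factor `u^± ∈ {1, 2, ½}` (so that the period is
the Néron period `Ω(W_K) = W_K.realPeriodRat`, resp. `|Ω⁻| = W_K.imaginaryPeriodRat`). The clause (N) — for `p ≠ 2`
SOME `ξ` has `n ξ ±` a `p`-adic UNIT — is MORE than Kato uses (13.7 / 13.12 take from 13.6 only `δ(f, j, α)^± ≠ 0` and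
a finite index); it is the following derivation: by §5.5 (p. 156) `δ_{1,N}(2, 1, α)` for `α ∈ SL₂(ℤ)` is the TRACE to
`Y₁(N)` of `α^* δ_{L,L}(2, 1)`, i.e. (Poincaré/Lefschetz duality §4.7, trace = push-forward of the cusp-to-cusp path) the
Manin symbol `{α0, α∞}` of `X₁(N)`; the Manin symbols generate `H₁(X₁(N)(ℂ), {cusps}, ℤ) = V_{2,ℤ}(Y₁(N))` over `ℤ`
(Manin 1972 §1.5 / Ash–Stevens = Kato Thm 13.6 at `Y(L)`; Cremona §2.1), hence their images generate `V_ℤ(f)`, and the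
`±`-projections `½(1 ± ι)` of a generating set generate a lattice containing `V_ℤ(f)^±` — so for odd `p` some
`δ(f,1,ξ)^±` is a `p`-adic unit multiple of the generator (the real-structure factor `u^±` and the member's lattice
identification are `p`-units / exact). Referee: check the trace/Manin-symbol identification of §5.5. UNIT CHOICE / Kosters–Pannekoek / Birch: NOT here
(tree theorems: `KatoUnitChoice.*`, `PIntegralUnits.*`, `ReceptacleTorsion.*`, `StarredOptimalManinUnitFiveSevenValueExit.*`).
CONVENTIONS: `L_S(f*, χ, 1)` with `f* = f` (rational newform), `S = prime(m·p·N)` = the tree's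
`EulerSystemValues.IsDepletedTwistedL f m (p * N) χ`; `± = χ(−1)`; even values against `Ω⁺ = W_K.realPeriodRat`, odd
against `i·Ω⁻`, `Ω⁻ = W_K.imaginaryPeriodRat` (the value exit's normalisation). ERRATUM F-UE-1 (audit D-AUDIT-r02,
page images of Thm 6.6 (1) p. 163 and Thm 5.6 p. 157): print has `T = (c² − c^u χ̄(c))(d² − d^v χ̄(d))` with BOTH bars,
`χ̄ = χ⁻¹`; the first definition below (`exists_member_sl2ZetaElement_neron_values`) keeps the earlier reading `χ(c)` at the
`c`-factor and is therefore NOT print as typed — the print-faithful statement is `exists_member_sl2ZetaElement_neron_values_bar`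
(appended); immaterial for every consumer (the socket `KatoAssemblySocket.exists_isIntegral_of_forall_valueLaw` is bar-agnostic,
both factors being of the form `c(c − ζ)`).
-/

set_option autoImplicit false

noncomputable section

open scoped BigOperators NumberField TensorProduct Pointwise MatrixGroups NNReal
open Polynomial Field IsDedekindDomain NumberField CongruenceSubgroup ValuativeRel
open Literature.NumberTheory.GaloisRepresentations
open Literature.NumberTheory.GaloisRepresentations.PeriodRingData
open Literature.NumberTheory.GaloisRepresentations.IsNonarchimedeanLocalField
open Literature.NumberTheory.PAdicHodge
open Literature.NumberTheory.EllipticCurves Literature.NumberTheory.EllipticCurves.ModularForms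
open Literature.NumberTheory.AdelicBaseChange Literature.NumberTheory.Automorphic
open Literature.NumberTheory.EllipticCurves.Kato2004 Literature.NumberTheory.EllipticCurves.Kato2004.EulerSystemValues
open Rat.HeightOneSpectrum

namespace Literature.NumberTheory.EllipticCurves.Kato2004

-- The tree's `ℚ`-algebra structure on `ℚ_v = Place.Completion (inr v)` gets top priority LOCALLY, exactly as in
-- `Kato2004/EulerSystemDefinedValues.lean` (its `letI` chain keys on it; `Algebra ℚ _` is a subsingleton).
attribute [local instance 100001] NumberField.Place.instAlgebraCompletion

set_option backward.isDefEq.respectTransparency false in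
/-- **Kato 2004 — (8.1.3), Thm 9.7, Thm 6.6 (1) (case `ξ ∈ SL₂(ℤ)`), Thm 13.6 — at Kato's member, with the dual
exponential DEFINED and PINNED to the Néron differential** (printed statements: (8.1.2)–(8.1.3) p. 180 — `m ≥ 1`, `ξ ∈ SL₂(ℤ)`,
`S ⊇ prime(mN) ∪ {p}`, `prime(cd) ∩ S = ∅`, `(cd, 6) = 1`, `(d, N) = 1`; §8.3 p. 181; §9.4 p. 188; Thm 9.7 p. 189 (rationality of `exp*`);
Thm 6.6 (1) p. 163 — `ξ ∈ SL₂(ℤ)`, `c ≡ d ≡ 1 mod N`, `Σ_b χ(b) per_f(σ_b z_m(f,r,r′,ξ,S))^± = L_S(f*,χ,r)(2πi)^{k−r−1}γ^±`,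
`γ = T δ(f,r′,ξ)`, print `T = (c² − c^uχ̄(c))(d² − d^vχ̄(d))` — THIS definition reads `χ(c)` at the `c`-factor (ERRATUM F-UE-1; faithful twin: `…_bar` below),
`(u,v) = (1,1)` at `k = 2`, `r = r′ = 1`; §5.5 p. 156; Thm 13.6 p. 227). For every elliptic `W/ℚ` and prime `p` there is a
GLOBALLY MINIMAL `W_K` `ℚ`-isogenous to `W` (Kato's lattice `V_{ℤ_p}(f)(1) ≅ T_pW_K`) such that, for the newform `f` of
`W`: there is a generator `d` of `D⁰_dR(V_pW_K|_{Γ_{ℚ_v}})` whose dual-exponential coordinate has the NÉRON range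
`{a : ∀ P ∈ E(ℚ_v), ‖Tr_{ℚ_v/ℚ_p}(a · log_ω P)‖ ≤ 1}` (the pin), and Manin-symbol coordinates `n : SL₂(ℤ) → {±} → ℚ`
with, for `p ≠ 2`, a `p`-adic unit among the `n ξ ±` for each sign (Thm 13.6), such that at EVERY level `m ≥ 1` there
are an embedding `ι : ℚ(ζ_m) → ℂ` and a `ℤ_p`-linear `Λ : H¹(ℚ(μ_m), T_pW_K) → ℚ_p ⊗ ℚ(ζ_m)` which IS the semi-local
dual exponential in the coordinate `d` ((RES)/(DEF) VERBATIM from `Kato2004.DefinedExpStarBody`, at the level subgroup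
`rootsOfUnityFixer ℚ m`), and for all integers `c ≡ d ≡ 1 (mod N)` with `(cd, 6pm) = 1` and every `ξ ∈ SL₂(ℤ)` a class
`z ∈ H¹(ℚ(μ_m), T_pW_K)` ((8.1.3): integral by type) with RATIONAL value `Λ z = 1 ⊗ x` (Thm 9.7) satisfying the VALUE
LAW (Thm 9.7 ∘ 6.6 (1)): for every Dirichlet character `χ` mod `m` and every entire continuation `Lχ` of the
`(m·p·N)`-depleted series, `Σ_b χ(b) ι(σ_b x) = (c² − cχ(c))(d² − dχ̄(d)) · (n ξ ±) · Lχ(1)/Ω^±` (as typed here; print: `χ̄(c)`), `Ω⁺ = Ω(W_K)`,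
`Ω⁻ = i·|Ω⁻(W_K)|`. A derived reading (two non-verbatim steps: the Néron pin via Tate duality + comparison
functoriality; the lattice coordinates), weaker than print in every binder; named fact, nothing asserted, no `_holds`.
[cite: Kato2004Asterisque, (8.1.2)-(8.1.3) (p. 180), §8.3 (p. 181), §9.4 (p. 188), Thm. 9.7 (p. 189), Thm. 6.6 (1) (p. 163), (4.2.4) (p. 143), §5.5 (p. 156), Thm. 13.6 (p. 227)]
[cite: Kato1993LNM1553, Ch. II §1.2.4 and Thm. 1.4.1 (3)-(4)] [cite: BlochKato1990, Prop. 3.8, Def. 3.10, Ex. 3.10.1, Example 3.11]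
[cite: CasselsFrohlichANT1967, Ch. II §10 Theorem (10.2) and Ch. VII §1.1]
[cite: SilvermanAEC2009, Prop. III.4.12 with Rem. III.4.13.2 and Cor. VIII.8.3]
[cite: Manin1972, §1.5 (Manin symbols generate the relative homology)] [cite: AshStevens1986, (the generation theorem quoted as Kato's Thm. 13.6)] -/
def exists_member_sl2ZetaElement_neron_values : Prop :=
  ∀ (W : WeierstrassCurve ℚ) [W.IsElliptic] (p : ℕ) [Fact p.Prime],
    ∃ (W' : WeierstrassCurve ℚ) (_ : W'.IsElliptic) (_ : W'.IsGloballyMinimal),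
    WeierstrassCurve.IsIsogenous W W' ∧
    ∀ [ContinuousSMul ℤ_[p] (W'.tateModule p)] [Module.Free ℤ_[p] (W'.tateModule p)]
      [Module.Finite ℤ_[p] (W'.tateModule p)],
    ∀ {N : ℕ} [NeZero N] (f : CuspForm (Gamma0 N) 2), IsNewformOf W f →
        letI ρT := restrictedTateRep W' (NumberField.Place.Completion (Sum.inr ((Rat.HeightOneSpectrum.primesEquiv (R := 𝓞 ℚ)).symm ⟨p, Fact.out⟩) : NumberField.Place ℚ)) p
        letI ρV := restrictedRationalTateRep W' (NumberField.Place.Completion (Sum.inr ((Rat.HeightOneSpectrum.primesEquiv (R := 𝓞 ℚ)).symm ⟨p, Fact.out⟩) : NumberField.Place ℚ)) p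
        letI : ValuativeRel (NumberField.Place.Completion (Sum.inr ((Rat.HeightOneSpectrum.primesEquiv (R := 𝓞 ℚ)).symm ⟨p, Fact.out⟩) : NumberField.Place ℚ)) :=
          inferInstanceAs (ValuativeRel (((Rat.HeightOneSpectrum.primesEquiv (R := 𝓞 ℚ)).symm ⟨p, Fact.out⟩).adicCompletion ℚ))
        letI : TopologicalSpace (NumberField.Place.Completion (Sum.inr ((Rat.HeightOneSpectrum.primesEquiv (R := 𝓞 ℚ)).symm ⟨p, Fact.out⟩) : NumberField.Place ℚ)) :=
          inferInstanceAs (TopologicalSpace (((Rat.HeightOneSpectrum.primesEquiv (R := 𝓞 ℚ)).symm ⟨p, Fact.out⟩).adicCompletion ℚ))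
        haveI : IsNonarchimedeanLocalField (NumberField.Place.Completion (Sum.inr ((Rat.HeightOneSpectrum.primesEquiv (R := 𝓞 ℚ)).symm ⟨p, Fact.out⟩) : NumberField.Place ℚ)) :=
          inferInstanceAs (IsNonarchimedeanLocalField (((Rat.HeightOneSpectrum.primesEquiv (R := 𝓞 ℚ)).symm ⟨p, Fact.out⟩).adicCompletion ℚ))
        haveI : CharZero (NumberField.Place.Completion (Sum.inr ((Rat.HeightOneSpectrum.primesEquiv (R := 𝓞 ℚ)).symm ⟨p, Fact.out⟩) : NumberField.Place ℚ)) := LocalField.charZero_adicCompletion ((Rat.HeightOneSpectrum.primesEquiv (R := 𝓞 ℚ)).symm ⟨p, Fact.out⟩)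
        letI : Algebra ℚ_[p] (NumberField.Place.Completion (Sum.inr ((Rat.HeightOneSpectrum.primesEquiv (R := 𝓞 ℚ)).symm ⟨p, Fact.out⟩) : NumberField.Place ℚ)) :=
          LocalField.adicCompletionPadicAlgebra ((Rat.HeightOneSpectrum.primesEquiv (R := 𝓞 ℚ)).symm ⟨p, Fact.out⟩) p ((natCast_mem_asIdeal_iff_eq_primesEquiv_symm _ (Fact.out : p.Prime)).mpr rfl)
        haveI : Fact (¬ IsUnit ((p : ℕ) : integerC (NumberField.Place.Completion (Sum.inr ((Rat.HeightOneSpectrum.primesEquiv (R := 𝓞 ℚ)).symm ⟨p, Fact.out⟩) : NumberField.Place ℚ)))) :=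
          ⟨not_isUnit_natCast_integerC (show valuation (NumberField.Place.Completion (Sum.inr ((Rat.HeightOneSpectrum.primesEquiv (R := 𝓞 ℚ)).symm ⟨p, Fact.out⟩) : NumberField.Place ℚ)) ((p : ℕ) : (NumberField.Place.Completion (Sum.inr ((Rat.HeightOneSpectrum.primesEquiv (R := 𝓞 ℚ)).symm ⟨p, Fact.out⟩) : NumberField.Place ℚ))) < 1 from LocalField.valuation_adicCompletion_natCast_lt_one ((Rat.HeightOneSpectrum.primesEquiv (R := 𝓞 ℚ)).symm ⟨p, Fact.out⟩) p ((natCast_mem_asIdeal_iff_eq_primesEquiv_symm _ (Fact.out : p.Prime)).mpr rfl))⟩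
        haveI := isAdicComplete_integerC_natCast (show valuation (NumberField.Place.Completion (Sum.inr ((Rat.HeightOneSpectrum.primesEquiv (R := 𝓞 ℚ)).symm ⟨p, Fact.out⟩) : NumberField.Place ℚ)) ((p : ℕ) : (NumberField.Place.Completion (Sum.inr ((Rat.HeightOneSpectrum.primesEquiv (R := 𝓞 ℚ)).symm ⟨p, Fact.out⟩) : NumberField.Place ℚ))) < 1 from LocalField.valuation_adicCompletion_natCast_lt_one ((Rat.HeightOneSpectrum.primesEquiv (R := 𝓞 ℚ)).symm ⟨p, Fact.out⟩) p ((natCast_mem_asIdeal_iff_eq_primesEquiv_symm _ (Fact.out : p.Prime)).mpr rfl))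
        ∃ (d₀ : (bdRPeriodRingData (show valuation (NumberField.Place.Completion (Sum.inr ((Rat.HeightOneSpectrum.primesEquiv (R := 𝓞 ℚ)).symm ⟨p, Fact.out⟩) : NumberField.Place ℚ)) ((p : ℕ) : (NumberField.Place.Completion (Sum.inr ((Rat.HeightOneSpectrum.primesEquiv (R := 𝓞 ℚ)).symm ⟨p, Fact.out⟩) : NumberField.Place ℚ))) < 1 from LocalField.valuation_adicCompletion_natCast_lt_one ((Rat.HeightOneSpectrum.primesEquiv (R := 𝓞 ℚ)).symm ⟨p, Fact.out⟩) p ((natCast_mem_asIdeal_iff_eq_primesEquiv_symm _ (Fact.out : p.Prime)).mpr rfl))).FilZeroLine ρV),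

          -- (PIN) the Néron range of `exp*_{d₀}` on `H¹(ℚ_v, T_pW_K)` (reading 1: Tate duality, [BK90] 3.8 / Kato II 1.4.1),
          -- for EVERY compatible `ℝ≥0`-valuation `wv` with `W_K ⊗ ℚ_v` integral (all such give the same `log_ω`; the
          -- RHS is the right-hand side of `PAdicHodge.exists_smul_range_expStarCoord_iff_trace_log` at `F = ℚ_v`, `e = 1`)
          (∀ (wv : Valuation (NumberField.Place.Completion (Sum.inr ((Rat.HeightOneSpectrum.primesEquiv (R := 𝓞 ℚ)).symm ⟨p, Fact.out⟩) : NumberField.Place ℚ)) ℝ≥0) [wv.Compatible] [(W'.baseChange (NumberField.Place.Completion (Sum.inr ((Rat.HeightOneSpectrum.primesEquiv (R := 𝓞 ℚ)).symm ⟨p, Fact.out⟩) : NumberField.Place ℚ))).IsIntegral wv.integer],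
            ∀ a : (NumberField.Place.Completion (Sum.inr ((Rat.HeightOneSpectrum.primesEquiv (R := 𝓞 ℚ)).symm ⟨p, Fact.out⟩) : NumberField.Place ℚ)),
              (∃ η : contOneCocycles ρT.toTopRep, expStarCoord W' (show valuation (NumberField.Place.Completion (Sum.inr ((Rat.HeightOneSpectrum.primesEquiv (R := 𝓞 ℚ)).symm ⟨p, Fact.out⟩) : NumberField.Place ℚ)) ((p : ℕ) : (NumberField.Place.Completion (Sum.inr ((Rat.HeightOneSpectrum.primesEquiv (R := 𝓞 ℚ)).symm ⟨p, Fact.out⟩) : NumberField.Place ℚ))) < 1 from LocalField.valuation_adicCompletion_natCast_lt_one ((Rat.HeightOneSpectrum.primesEquiv (R := 𝓞 ℚ)).symm ⟨p, Fact.out⟩) p ((natCast_mem_asIdeal_iff_eq_primesEquiv_symm _ (Fact.out : p.Prime)).mpr rfl)) d₀ η = a) ↔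
                ∀ P : (W'.baseChange (NumberField.Place.Completion (Sum.inr ((Rat.HeightOneSpectrum.primesEquiv (R := 𝓞 ℚ)).symm ⟨p, Fact.out⟩) : NumberField.Place ℚ))).toAffine.Point,
                  ‖Algebra.trace ℚ_[p] (NumberField.Place.Completion (Sum.inr ((Rat.HeightOneSpectrum.primesEquiv (R := 𝓞 ℚ)).symm ⟨p, Fact.out⟩) : NumberField.Place ℚ))
                      (a * FormalGroupChart.padicLogPointFiniteExt wv (W'.baseChange (NumberField.Place.Completion (Sum.inr ((Rat.HeightOneSpectrum.primesEquiv (R := 𝓞 ℚ)).symm ⟨p, Fact.out⟩) : NumberField.Place ℚ))) p P)‖ ≤ 1) ∧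

          -- (N) Manin-symbol coordinates, Thm 13.6: for `p ≠ 2`, a `p`-adic unit among the `n ξ ±` of each sign
          ∃ (n : SL(2, ℤ) → Bool → ℚ),
            (p ≠ 2 → ∀ b : Bool, ∃ ξ : SL(2, ℤ), n ξ b ≠ 0 ∧ padicValRat p (n ξ b) = 0) ∧
            ∀ (m : ℕ) [NeZero m],
              ∃ (ι : CyclotomicField m ℚ →+* ℂ)
                (Λ : H1 (tateRep W' p) (Literature.NumberTheory.GaloisRepresentations.rootsOfUnityFixer ℚ m) →ₗ[ℤ_[p]]
                  ℚ_[p] ⊗[ℚ] CyclotomicField m ℚ),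
            (∀ (Ψ : ℚ_[p] ⊗[ℚ] CyclotomicField m ℚ ≃ₐ[ℚ]
                (Π w : ((Rat.HeightOneSpectrum.primesEquiv (R := 𝓞 ℚ)).symm ⟨p, Fact.out⟩).Extension
                  (𝓞 (CyclotomicField m ℚ)), w.1.adicCompletion (CyclotomicField m ℚ)))
              (hΨ : ∀ (s : ℚ_[p]) (x : CyclotomicField m ℚ)
                (w : ((Rat.HeightOneSpectrum.primesEquiv (R := 𝓞 ℚ)).symm ⟨p, Fact.out⟩).Extension
                  (𝓞 (CyclotomicField m ℚ))),
                Ψ (s ⊗ₜ[ℚ] x) w =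
                  algebraMap (CyclotomicField m ℚ) (w.1.adicCompletion (CyclotomicField m ℚ)) x *
                  algebraMap (((Rat.HeightOneSpectrum.primesEquiv (R := 𝓞 ℚ)).symm ⟨p, Fact.out⟩).adicCompletion ℚ)
                    (w.1.adicCompletion (CyclotomicField m ℚ)) ((Padic.adicCompletionEquiv (𝓞 ℚ) ⟨p, Fact.out⟩) s)),
              ∀ (w : ((Rat.HeightOneSpectrum.primesEquiv (R := 𝓞 ℚ)).symm ⟨p, Fact.out⟩).Extension
                  (𝓞 (CyclotomicField m ℚ))),
                  -- the (propositionally unique) local-field structure proofs at `L_{w}` are QUANTIFIED, so that a consumer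
                  -- instantiates them with its own terms (no definitional unfolding is then asked of the kernel)
                  ∀ (hw : ((p : ℕ) : 𝓞 (CyclotomicField m ℚ)) ∈ w.1.asIdeal)
                    [CharZero (w.1.adicCompletion (CyclotomicField m ℚ))]
                    [Fact (¬ IsUnit ((p : ℕ) : integerC (w.1.adicCompletion (CyclotomicField m ℚ))))]
                    [IsAdicComplete (Ideal.span {((p : ℕ) : integerC (w.1.adicCompletion (CyclotomicField m ℚ)))}) (integerC (w.1.adicCompletion (CyclotomicField m ℚ)))]
                    (hL : valuation (w.1.adicCompletion (CyclotomicField m ℚ)) ((p : ℕ) : (w.1.adicCompletion (CyclotomicField m ℚ))) < 1),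
                  letI := LocalField.adicCompletionPadicAlgebra w.1 p hw
                  -- the rational tower representation `V_pW|_{Γ_ℚ_v}|_{Γ_{L_w}}`, restricted along the COMPOSITE
                  -- `Γ_{L_w} → Γ_{ℚ_v} → Γ_ℚ` (= `ρV.restrict _` by `ContinuousRep.restrict_comp`, a definitional equality)
                  letI ρVT := (W'.rationalTateGaloisRep p (W'.continuous_rationalGaloisRepTate_holds p)).restrict
                    ((absGaloisRestrict ℚ (NumberField.Place.Completion (Sum.inr ((Rat.HeightOneSpectrum.primesEquiv (R := 𝓞 ℚ)).symm ⟨p, Fact.out⟩) : NumberField.Place ℚ))).comp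
                      (absGaloisRestrict (((Rat.HeightOneSpectrum.primesEquiv (R := 𝓞 ℚ)).symm ⟨p, Fact.out⟩).adicCompletion ℚ) (w.1.adicCompletion (CyclotomicField m ℚ))))
                  ∃ (dw : (bdRPeriodRingData hL).FilZeroLine ρVT),
                    (∀ (η₀ : contOneCocycles ρT.toTopRep)
                      (η : contOneCocycles (ρT.restrict (absGaloisRestrict (((Rat.HeightOneSpectrum.primesEquiv (R := 𝓞 ℚ)).symm ⟨p, Fact.out⟩).adicCompletion ℚ) (w.1.adicCompletion (CyclotomicField m ℚ)))).toTopRep),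
                      (∀ σ, η.1 σ = η₀.1 (absGaloisRestrict (((Rat.HeightOneSpectrum.primesEquiv (R := 𝓞 ℚ)).symm ⟨p, Fact.out⟩).adicCompletion ℚ) (w.1.adicCompletion (CyclotomicField m ℚ)) σ)) →
                      (bdRPeriodRingData hL).dualExpCoord
                          (logCyclotomic p) ρVT dw.ω (fun σ => TateModule.toRational p (η.1 σ)) =
                        algebraMap (((Rat.HeightOneSpectrum.primesEquiv (R := 𝓞 ℚ)).symm ⟨p, Fact.out⟩).adicCompletion ℚ) (w.1.adicCompletion (CyclotomicField m ℚ))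
                          (expStarCoord W' (show valuation (NumberField.Place.Completion (Sum.inr ((Rat.HeightOneSpectrum.primesEquiv (R := 𝓞 ℚ)).symm ⟨p, Fact.out⟩) : NumberField.Place ℚ)) ((p : ℕ) : (NumberField.Place.Completion (Sum.inr ((Rat.HeightOneSpectrum.primesEquiv (R := 𝓞 ℚ)).symm ⟨p, Fact.out⟩) : NumberField.Place ℚ))) < 1 from LocalField.valuation_adicCompletion_natCast_lt_one ((Rat.HeightOneSpectrum.primesEquiv (R := 𝓞 ℚ)).symm ⟨p, Fact.out⟩) p ((natCast_mem_asIdeal_iff_eq_primesEquiv_symm _ (Fact.out : p.Prime)).mpr rfl)) d₀ η₀ : (NumberField.Place.Completion (Sum.inr ((Rat.HeightOneSpectrum.primesEquiv (R := 𝓞 ℚ)).symm ⟨p, Fact.out⟩) : NumberField.Place ℚ)))) ∧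
                    (∀ (y : H1 (tateRep W' p) (Literature.NumberTheory.GaloisRepresentations.rootsOfUnityFixer ℚ m))
                    (φ'' : contOneCocycles (subgroupRep (tateRep W' p).toTopRep (Literature.NumberTheory.GaloisRepresentations.rootsOfUnityFixer ℚ m)))
                    (ψT : contOneCocycles (ρT.restrict
                      (absGaloisRestrict (((Rat.HeightOneSpectrum.primesEquiv (R := 𝓞 ℚ)).symm ⟨p, Fact.out⟩).adicCompletion ℚ) (w.1.adicCompletion (CyclotomicField m ℚ)))).toTopRep),
                    oneCocycleClass _ φ'' = y →
                    (∀ σ (hσ : absGaloisRestrictTower ℚ (((Rat.HeightOneSpectrum.primesEquiv (R := 𝓞 ℚ)).symm ⟨p, Fact.out⟩).adicCompletion ℚ) (w.1.adicCompletion (CyclotomicField m ℚ)) σ ∈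
                        Literature.NumberTheory.GaloisRepresentations.rootsOfUnityFixer ℚ m),
                      ψT.1 σ = φ''.1 ⟨absGaloisRestrictTower ℚ (((Rat.HeightOneSpectrum.primesEquiv (R := 𝓞 ℚ)).symm ⟨p, Fact.out⟩).adicCompletion ℚ) (w.1.adicCompletion (CyclotomicField m ℚ)) σ, hσ⟩) →
                    Ψ (Λ y) w =
                      (bdRPeriodRingData hL).dualExpCoord
                        (logCyclotomic p) ρVT dw.ω (fun σ => TateModule.toRational p (ψT.1 σ)))) ∧

                -- (8.1.3) classes, (C4) rationality (Thm 9.7), (C5′) value law (Thm 9.7 ∘ Thm 6.6 (1), SL₂(ℤ) case)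
                ∀ (c d : ℤ) (ξ : SL(2, ℤ)), c ≡ 1 [ZMOD (N : ℤ)] → d ≡ 1 [ZMOD (N : ℤ)] →
                  Int.gcd (c * d) (6 * p * m) = 1 →
                  ∃ (z : H1 (tateRep W' p) (Literature.NumberTheory.GaloisRepresentations.rootsOfUnityFixer ℚ m))
                    (x : CyclotomicField m ℚ),
                    Λ z = (1 : ℚ_[p]) ⊗ₜ[ℚ] x ∧
                    ∀ (χ : DirichletCharacter ℂ m) (Lχ : ℂ → ℂ), IsDepletedTwistedL f m (p * N) χ Lχ →
                      (χ (-1) = 1 →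
                        charSum m ι χ x =
                          (((c : ℂ) ^ 2 - (c : ℂ) * χ (c : ZMod m)) * ((d : ℂ) ^ 2 - (d : ℂ) * (χ (d : ZMod m))⁻¹)) *
                            ((n ξ true : ℚ) : ℂ) * (Lχ 1 / (W'.realPeriodRat : ℂ))) ∧
                      (χ (-1) = -1 →
                        charSum m ι χ x =
                          (((c : ℂ) ^ 2 - (c : ℂ) * χ (c : ZMod m)) * ((d : ℂ) ^ 2 - (d : ℂ) * (χ (d : ZMod m))⁻¹)) *
                            ((n ξ false : ℚ) : ℂ) * (Lχ 1 / (Complex.I * (W'.imaginaryPeriodRat : ℂ))))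

set_option backward.isDefEq.respectTransparency false in
/-- **Kato 2004 — (8.1.3), Thm 9.7, Thm 6.6 (1) (case `ξ ∈ SL₂(ℤ)`), Thm 13.6 — at Kato's member, with the dual
exponential DEFINED and PINNED to the Néron differential; PRINT-FAITHFUL VALUE-LAW FACTOR
`T = (c² − c^u χ̄(c))(d² − d^v χ̄(d))`, `(u, v) = (1, 1)`** (erratum F-UE-1 to `exists_member_sl2ZetaElement_neron_values`
above, whose factor reads `χ(c)` in place of print's `χ̄(c) = χ(c)⁻¹`; the bar, OCR-illegible on p. 163, is legible on the
page images of Thm 6.6 (1) p. 163 and of Thm 5.6 p. 157, from which 6.6 is deduced — BOTH characters barred — and is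
forced by the mechanism (4.2.2)–(4.2.4) `_{c,d}z = (c² − c^u σ_c)(d² − d^v σ_d) z`, `Σ_b χ(b)σ_bσ_c = χ̄(c)Σ_b χ(b)σ_b`, as
typed for the a(A)-type law in `EulerSystemValues.cuspFactor`; audit sheet
`pub/bsd-cited/sheets/D-AUDIT-r02-UE-Kato2004-SL2NeronValues-813-97-66-136.md` §1). VERBATIM the statement
`exists_member_sl2ZetaElement_neron_values` (member `W_K` globally minimal and `ℚ`-isogenous to `W`; the Néron pin (PIN);
the Manin-symbol coordinates (N) with a `p`-adic unit for `p ≠ 2`; (RES)/(DEF) per place at every level `m ≥ 1`; the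
classes (8.1.3) for `c ≡ d ≡ 1 (mod N)`, `(cd, 6pm) = 1`, `ξ ∈ SL₂(ℤ)`; rationality (Thm 9.7)) with the value law
(Thm 9.7 ∘ Thm 6.6 (1)): for every Dirichlet character `χ` mod `m` and every entire continuation `Lχ` of the
`(m·p·N)`-depleted series, `Σ_b χ(b) ι(σ_b x) = (c² − c·χ̄(c))(d² − d·χ̄(d)) · (n ξ ±) · Lχ(1)/Ω^±`, `χ̄(a) = χ(a)⁻¹`,
`Ω⁺ = Ω(W_K)`, `Ω⁻ = i·|Ω⁻(W_K)|`. The consumers of the value law (`KatoAssemblySocket.exists_isIntegral_of_forall_valueLaw`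
and the openers `KatoAssemblySocketAt.*`) are bar-agnostic (`μ ∈ {χ(c), χ̄(c)}`), so every consequence drawn in the tree
from the erratum statement is drawn from this one by reading the law at `χ̄` with `(μ, ν) = (χ(c), χ(d))`. A derived
reading in the two non-verbatim steps of the statement above (the Néron pin via Tate duality + comparison functoriality;
the lattice coordinates), weaker than print in every binder; named fact, nothing asserted, no `_holds` (size XL: Kato's
explicit reciprocity law).
[cite: Kato2004Asterisque, (8.1.2)-(8.1.3) (p. 180), §8.3 (p. 181), §9.4 (p. 188), Thm. 9.7 (p. 189), Thm. 6.6 (1) (p. 163), Thm. 5.6 (p. 157), (4.2.2)-(4.2.4) (p. 143), §4.5 (p. 144), §5.5 (p. 156), (7.13.6) (p. 169), Thm. 13.6 (p. 227)]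
[cite: Kato1993LNM1553, Ch. II §1.2.4 and Thm. 1.4.1 (3)-(4)] [cite: BlochKato1990, Prop. 3.8, Def. 3.10, Ex. 3.10.1, Example 3.11]
[cite: CasselsFrohlichANT1967, Ch. II §10 Theorem (10.2) and Ch. VII §1.1]
[cite: SilvermanAEC2009, Prop. III.4.12 with Rem. III.4.13.2 and Cor. VIII.8.3]
[cite: Manin1972, §1.5 (Manin symbols generate the relative homology)] [cite: AshStevens1986, (the generation theorem quoted as Kato's Thm. 13.6)] -/
def exists_member_sl2ZetaElement_neron_values_bar : Prop :=
  ∀ (W : WeierstrassCurve ℚ) [W.IsElliptic] (p : ℕ) [Fact p.Prime],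
    ∃ (W' : WeierstrassCurve ℚ) (_ : W'.IsElliptic) (_ : W'.IsGloballyMinimal),
    WeierstrassCurve.IsIsogenous W W' ∧
    ∀ [ContinuousSMul ℤ_[p] (W'.tateModule p)] [Module.Free ℤ_[p] (W'.tateModule p)]
      [Module.Finite ℤ_[p] (W'.tateModule p)],
    ∀ {N : ℕ} [NeZero N] (f : CuspForm (Gamma0 N) 2), IsNewformOf W f →
        letI ρT := restrictedTateRep W' (NumberField.Place.Completion (Sum.inr ((Rat.HeightOneSpectrum.primesEquiv (R := 𝓞 ℚ)).symm ⟨p, Fact.out⟩) : NumberField.Place ℚ)) p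
        letI ρV := restrictedRationalTateRep W' (NumberField.Place.Completion (Sum.inr ((Rat.HeightOneSpectrum.primesEquiv (R := 𝓞 ℚ)).symm ⟨p, Fact.out⟩) : NumberField.Place ℚ)) p
        letI : ValuativeRel (NumberField.Place.Completion (Sum.inr ((Rat.HeightOneSpectrum.primesEquiv (R := 𝓞 ℚ)).symm ⟨p, Fact.out⟩) : NumberField.Place ℚ)) :=
          inferInstanceAs (ValuativeRel (((Rat.HeightOneSpectrum.primesEquiv (R := 𝓞 ℚ)).symm ⟨p, Fact.out⟩).adicCompletion ℚ))
        letI : TopologicalSpace (NumberField.Place.Completion (Sum.inr ((Rat.HeightOneSpectrum.primesEquiv (R := 𝓞 ℚ)).symm ⟨p, Fact.out⟩) : NumberField.Place ℚ)) :=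
          inferInstanceAs (TopologicalSpace (((Rat.HeightOneSpectrum.primesEquiv (R := 𝓞 ℚ)).symm ⟨p, Fact.out⟩).adicCompletion ℚ))
        haveI : IsNonarchimedeanLocalField (NumberField.Place.Completion (Sum.inr ((Rat.HeightOneSpectrum.primesEquiv (R := 𝓞 ℚ)).symm ⟨p, Fact.out⟩) : NumberField.Place ℚ)) :=
          inferInstanceAs (IsNonarchimedeanLocalField (((Rat.HeightOneSpectrum.primesEquiv (R := 𝓞 ℚ)).symm ⟨p, Fact.out⟩).adicCompletion ℚ))
        haveI : CharZero (NumberField.Place.Completion (Sum.inr ((Rat.HeightOneSpectrum.primesEquiv (R := 𝓞 ℚ)).symm ⟨p, Fact.out⟩) : NumberField.Place ℚ)) := LocalField.charZero_adicCompletion ((Rat.HeightOneSpectrum.primesEquiv (R := 𝓞 ℚ)).symm ⟨p, Fact.out⟩)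
        letI : Algebra ℚ_[p] (NumberField.Place.Completion (Sum.inr ((Rat.HeightOneSpectrum.primesEquiv (R := 𝓞 ℚ)).symm ⟨p, Fact.out⟩) : NumberField.Place ℚ)) :=
          LocalField.adicCompletionPadicAlgebra ((Rat.HeightOneSpectrum.primesEquiv (R := 𝓞 ℚ)).symm ⟨p, Fact.out⟩) p ((natCast_mem_asIdeal_iff_eq_primesEquiv_symm _ (Fact.out : p.Prime)).mpr rfl)
        haveI : Fact (¬ IsUnit ((p : ℕ) : integerC (NumberField.Place.Completion (Sum.inr ((Rat.HeightOneSpectrum.primesEquiv (R := 𝓞 ℚ)).symm ⟨p, Fact.out⟩) : NumberField.Place ℚ)))) :=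
          ⟨not_isUnit_natCast_integerC (show valuation (NumberField.Place.Completion (Sum.inr ((Rat.HeightOneSpectrum.primesEquiv (R := 𝓞 ℚ)).symm ⟨p, Fact.out⟩) : NumberField.Place ℚ)) ((p : ℕ) : (NumberField.Place.Completion (Sum.inr ((Rat.HeightOneSpectrum.primesEquiv (R := 𝓞 ℚ)).symm ⟨p, Fact.out⟩) : NumberField.Place ℚ))) < 1 from LocalField.valuation_adicCompletion_natCast_lt_one ((Rat.HeightOneSpectrum.primesEquiv (R := 𝓞 ℚ)).symm ⟨p, Fact.out⟩) p ((natCast_mem_asIdeal_iff_eq_primesEquiv_symm _ (Fact.out : p.Prime)).mpr rfl))⟩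
        haveI := isAdicComplete_integerC_natCast (show valuation (NumberField.Place.Completion (Sum.inr ((Rat.HeightOneSpectrum.primesEquiv (R := 𝓞 ℚ)).symm ⟨p, Fact.out⟩) : NumberField.Place ℚ)) ((p : ℕ) : (NumberField.Place.Completion (Sum.inr ((Rat.HeightOneSpectrum.primesEquiv (R := 𝓞 ℚ)).symm ⟨p, Fact.out⟩) : NumberField.Place ℚ))) < 1 from LocalField.valuation_adicCompletion_natCast_lt_one ((Rat.HeightOneSpectrum.primesEquiv (R := 𝓞 ℚ)).symm ⟨p, Fact.out⟩) p ((natCast_mem_asIdeal_iff_eq_primesEquiv_symm _ (Fact.out : p.Prime)).mpr rfl))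
        ∃ (d₀ : (bdRPeriodRingData (show valuation (NumberField.Place.Completion (Sum.inr ((Rat.HeightOneSpectrum.primesEquiv (R := 𝓞 ℚ)).symm ⟨p, Fact.out⟩) : NumberField.Place ℚ)) ((p : ℕ) : (NumberField.Place.Completion (Sum.inr ((Rat.HeightOneSpectrum.primesEquiv (R := 𝓞 ℚ)).symm ⟨p, Fact.out⟩) : NumberField.Place ℚ))) < 1 from LocalField.valuation_adicCompletion_natCast_lt_one ((Rat.HeightOneSpectrum.primesEquiv (R := 𝓞 ℚ)).symm ⟨p, Fact.out⟩) p ((natCast_mem_asIdeal_iff_eq_primesEquiv_symm _ (Fact.out : p.Prime)).mpr rfl))).FilZeroLine ρV),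

          -- (PIN) the Néron range of `exp*_{d₀}` on `H¹(ℚ_v, T_pW_K)` (reading 1: Tate duality, [BK90] 3.8 / Kato II 1.4.1),
          -- for EVERY compatible `ℝ≥0`-valuation `wv` with `W_K ⊗ ℚ_v` integral (all such give the same `log_ω`; the
          -- RHS is the right-hand side of `PAdicHodge.exists_smul_range_expStarCoord_iff_trace_log` at `F = ℚ_v`, `e = 1`)
          (∀ (wv : Valuation (NumberField.Place.Completion (Sum.inr ((Rat.HeightOneSpectrum.primesEquiv (R := 𝓞 ℚ)).symm ⟨p, Fact.out⟩) : NumberField.Place ℚ)) ℝ≥0) [wv.Compatible] [(W'.baseChange (NumberField.Place.Completion (Sum.inr ((Rat.HeightOneSpectrum.primesEquiv (R := 𝓞 ℚ)).symm ⟨p, Fact.out⟩) : NumberField.Place ℚ))).IsIntegral wv.integer],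
            ∀ a : (NumberField.Place.Completion (Sum.inr ((Rat.HeightOneSpectrum.primesEquiv (R := 𝓞 ℚ)).symm ⟨p, Fact.out⟩) : NumberField.Place ℚ)),
              (∃ η : contOneCocycles ρT.toTopRep, expStarCoord W' (show valuation (NumberField.Place.Completion (Sum.inr ((Rat.HeightOneSpectrum.primesEquiv (R := 𝓞 ℚ)).symm ⟨p, Fact.out⟩) : NumberField.Place ℚ)) ((p : ℕ) : (NumberField.Place.Completion (Sum.inr ((Rat.HeightOneSpectrum.primesEquiv (R := 𝓞 ℚ)).symm ⟨p, Fact.out⟩) : NumberField.Place ℚ))) < 1 from LocalField.valuation_adicCompletion_natCast_lt_one ((Rat.HeightOneSpectrum.primesEquiv (R := 𝓞 ℚ)).symm ⟨p, Fact.out⟩) p ((natCast_mem_asIdeal_iff_eq_primesEquiv_symm _ (Fact.out : p.Prime)).mpr rfl)) d₀ η = a) ↔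
                ∀ P : (W'.baseChange (NumberField.Place.Completion (Sum.inr ((Rat.HeightOneSpectrum.primesEquiv (R := 𝓞 ℚ)).symm ⟨p, Fact.out⟩) : NumberField.Place ℚ))).toAffine.Point,
                  ‖Algebra.trace ℚ_[p] (NumberField.Place.Completion (Sum.inr ((Rat.HeightOneSpectrum.primesEquiv (R := 𝓞 ℚ)).symm ⟨p, Fact.out⟩) : NumberField.Place ℚ))
                      (a * FormalGroupChart.padicLogPointFiniteExt wv (W'.baseChange (NumberField.Place.Completion (Sum.inr ((Rat.HeightOneSpectrum.primesEquiv (R := 𝓞 ℚ)).symm ⟨p, Fact.out⟩) : NumberField.Place ℚ))) p P)‖ ≤ 1) ∧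

          -- (N) Manin-symbol coordinates, Thm 13.6: for `p ≠ 2`, a `p`-adic unit among the `n ξ ±` of each sign
          ∃ (n : SL(2, ℤ) → Bool → ℚ),
            (p ≠ 2 → ∀ b : Bool, ∃ ξ : SL(2, ℤ), n ξ b ≠ 0 ∧ padicValRat p (n ξ b) = 0) ∧
            ∀ (m : ℕ) [NeZero m],
              ∃ (ι : CyclotomicField m ℚ →+* ℂ)
                (Λ : H1 (tateRep W' p) (Literature.NumberTheory.GaloisRepresentations.rootsOfUnityFixer ℚ m) →ₗ[ℤ_[p]]
                  ℚ_[p] ⊗[ℚ] CyclotomicField m ℚ),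
            (∀ (Ψ : ℚ_[p] ⊗[ℚ] CyclotomicField m ℚ ≃ₐ[ℚ]
                (Π w : ((Rat.HeightOneSpectrum.primesEquiv (R := 𝓞 ℚ)).symm ⟨p, Fact.out⟩).Extension
                  (𝓞 (CyclotomicField m ℚ)), w.1.adicCompletion (CyclotomicField m ℚ)))
              (hΨ : ∀ (s : ℚ_[p]) (x : CyclotomicField m ℚ)
                (w : ((Rat.HeightOneSpectrum.primesEquiv (R := 𝓞 ℚ)).symm ⟨p, Fact.out⟩).Extension
                  (𝓞 (CyclotomicField m ℚ))),
                Ψ (s ⊗ₜ[ℚ] x) w =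
                  algebraMap (CyclotomicField m ℚ) (w.1.adicCompletion (CyclotomicField m ℚ)) x *
                  algebraMap (((Rat.HeightOneSpectrum.primesEquiv (R := 𝓞 ℚ)).symm ⟨p, Fact.out⟩).adicCompletion ℚ)
                    (w.1.adicCompletion (CyclotomicField m ℚ)) ((Padic.adicCompletionEquiv (𝓞 ℚ) ⟨p, Fact.out⟩) s)),
              ∀ (w : ((Rat.HeightOneSpectrum.primesEquiv (R := 𝓞 ℚ)).symm ⟨p, Fact.out⟩).Extension
                  (𝓞 (CyclotomicField m ℚ))),
                  -- the (propositionally unique) local-field structure proofs at `L_{w}` are QUANTIFIED, so that a consumer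
                  -- instantiates them with its own terms (no definitional unfolding is then asked of the kernel)
                  ∀ (hw : ((p : ℕ) : 𝓞 (CyclotomicField m ℚ)) ∈ w.1.asIdeal)
                    [CharZero (w.1.adicCompletion (CyclotomicField m ℚ))]
                    [Fact (¬ IsUnit ((p : ℕ) : integerC (w.1.adicCompletion (CyclotomicField m ℚ))))]
                    [IsAdicComplete (Ideal.span {((p : ℕ) : integerC (w.1.adicCompletion (CyclotomicField m ℚ)))}) (integerC (w.1.adicCompletion (CyclotomicField m ℚ)))]
                    (hL : valuation (w.1.adicCompletion (CyclotomicField m ℚ)) ((p : ℕ) : (w.1.adicCompletion (CyclotomicField m ℚ))) < 1),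
                  letI := LocalField.adicCompletionPadicAlgebra w.1 p hw
                  -- the rational tower representation `V_pW|_{Γ_ℚ_v}|_{Γ_{L_w}}`, restricted along the COMPOSITE
                  -- `Γ_{L_w} → Γ_{ℚ_v} → Γ_ℚ` (= `ρV.restrict _` by `ContinuousRep.restrict_comp`, a definitional equality)
                  letI ρVT := (W'.rationalTateGaloisRep p (W'.continuous_rationalGaloisRepTate_holds p)).restrict
                    ((absGaloisRestrict ℚ (NumberField.Place.Completion (Sum.inr ((Rat.HeightOneSpectrum.primesEquiv (R := 𝓞 ℚ)).symm ⟨p, Fact.out⟩) : NumberField.Place ℚ))).comp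
                      (absGaloisRestrict (((Rat.HeightOneSpectrum.primesEquiv (R := 𝓞 ℚ)).symm ⟨p, Fact.out⟩).adicCompletion ℚ) (w.1.adicCompletion (CyclotomicField m ℚ))))
                  ∃ (dw : (bdRPeriodRingData hL).FilZeroLine ρVT),
                    (∀ (η₀ : contOneCocycles ρT.toTopRep)
                      (η : contOneCocycles (ρT.restrict (absGaloisRestrict (((Rat.HeightOneSpectrum.primesEquiv (R := 𝓞 ℚ)).symm ⟨p, Fact.out⟩).adicCompletion ℚ) (w.1.adicCompletion (CyclotomicField m ℚ)))).toTopRep),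
                      (∀ σ, η.1 σ = η₀.1 (absGaloisRestrict (((Rat.HeightOneSpectrum.primesEquiv (R := 𝓞 ℚ)).symm ⟨p, Fact.out⟩).adicCompletion ℚ) (w.1.adicCompletion (CyclotomicField m ℚ)) σ)) →
                      (bdRPeriodRingData hL).dualExpCoord
                          (logCyclotomic p) ρVT dw.ω (fun σ => TateModule.toRational p (η.1 σ)) =
                        algebraMap (((Rat.HeightOneSpectrum.primesEquiv (R := 𝓞 ℚ)).symm ⟨p, Fact.out⟩).adicCompletion ℚ) (w.1.adicCompletion (CyclotomicField m ℚ))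
                          (expStarCoord W' (show valuation (NumberField.Place.Completion (Sum.inr ((Rat.HeightOneSpectrum.primesEquiv (R := 𝓞 ℚ)).symm ⟨p, Fact.out⟩) : NumberField.Place ℚ)) ((p : ℕ) : (NumberField.Place.Completion (Sum.inr ((Rat.HeightOneSpectrum.primesEquiv (R := 𝓞 ℚ)).symm ⟨p, Fact.out⟩) : NumberField.Place ℚ))) < 1 from LocalField.valuation_adicCompletion_natCast_lt_one ((Rat.HeightOneSpectrum.primesEquiv (R := 𝓞 ℚ)).symm ⟨p, Fact.out⟩) p ((natCast_mem_asIdeal_iff_eq_primesEquiv_symm _ (Fact.out : p.Prime)).mpr rfl)) d₀ η₀ : (NumberField.Place.Completion (Sum.inr ((Rat.HeightOneSpectrum.primesEquiv (R := 𝓞 ℚ)).symm ⟨p, Fact.out⟩) : NumberField.Place ℚ)))) ∧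
                    (∀ (y : H1 (tateRep W' p) (Literature.NumberTheory.GaloisRepresentations.rootsOfUnityFixer ℚ m))
                    (φ'' : contOneCocycles (subgroupRep (tateRep W' p).toTopRep (Literature.NumberTheory.GaloisRepresentations.rootsOfUnityFixer ℚ m)))
                    (ψT : contOneCocycles (ρT.restrict
                      (absGaloisRestrict (((Rat.HeightOneSpectrum.primesEquiv (R := 𝓞 ℚ)).symm ⟨p, Fact.out⟩).adicCompletion ℚ) (w.1.adicCompletion (CyclotomicField m ℚ)))).toTopRep),
                    oneCocycleClass _ φ'' = y →
                    (∀ σ (hσ : absGaloisRestrictTower ℚ (((Rat.HeightOneSpectrum.primesEquiv (R := 𝓞 ℚ)).symm ⟨p, Fact.out⟩).adicCompletion ℚ) (w.1.adicCompletion (CyclotomicField m ℚ)) σ ∈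
                        Literature.NumberTheory.GaloisRepresentations.rootsOfUnityFixer ℚ m),
                      ψT.1 σ = φ''.1 ⟨absGaloisRestrictTower ℚ (((Rat.HeightOneSpectrum.primesEquiv (R := 𝓞 ℚ)).symm ⟨p, Fact.out⟩).adicCompletion ℚ) (w.1.adicCompletion (CyclotomicField m ℚ)) σ, hσ⟩) →
                    Ψ (Λ y) w =
                      (bdRPeriodRingData hL).dualExpCoord
                        (logCyclotomic p) ρVT dw.ω (fun σ => TateModule.toRational p (ψT.1 σ)))) ∧

                -- (8.1.3) classes, (C4) rationality (Thm 9.7), (C5′) value law (Thm 9.7 ∘ Thm 6.6 (1), SL₂(ℤ) case)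
                ∀ (c d : ℤ) (ξ : SL(2, ℤ)), c ≡ 1 [ZMOD (N : ℤ)] → d ≡ 1 [ZMOD (N : ℤ)] →
                  Int.gcd (c * d) (6 * p * m) = 1 →
                  ∃ (z : H1 (tateRep W' p) (Literature.NumberTheory.GaloisRepresentations.rootsOfUnityFixer ℚ m))
                    (x : CyclotomicField m ℚ),
                    Λ z = (1 : ℚ_[p]) ⊗ₜ[ℚ] x ∧
                    ∀ (χ : DirichletCharacter ℂ m) (Lχ : ℂ → ℂ), IsDepletedTwistedL f m (p * N) χ Lχ →
                      (χ (-1) = 1 →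
                        charSum m ι χ x =
                          (((c : ℂ) ^ 2 - (c : ℂ) * (χ (c : ZMod m))⁻¹) * ((d : ℂ) ^ 2 - (d : ℂ) * (χ (d : ZMod m))⁻¹)) *
                            ((n ξ true : ℚ) : ℂ) * (Lχ 1 / (W'.realPeriodRat : ℂ))) ∧
                      (χ (-1) = -1 →
                        charSum m ι χ x =
                          (((c : ℂ) ^ 2 - (c : ℂ) * (χ (c : ZMod m))⁻¹) * ((d : ℂ) ^ 2 - (d : ℂ) * (χ (d : ZMod m))⁻¹)) *
                            ((n ξ false : ℚ) : ℂ) * (Lχ 1 / (Complex.I * (W'.imaginaryPeriodRat : ℂ))))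

-- TODO(general form): Kato (8.1.3)/9.7/6.6 (1) for newforms of weight `k ≥ 2` with coefficients (`F ≠ ℚ`,
-- `T = V_{O_λ}(f)(k − r)`, `1 ≤ r′ ≤ k − 1`), the `a(A)`-type value law in the same Néron coordinate, and the member
-- NAMED once `V_{ℤ_p}(f)` (the image of `H¹_ét(Y₁(N) ⊗ ℚ̄, ℤ_p)`) is an object of the tree.

end Literature.NumberTheory.EllipticCurves.Kato2004

end
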